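import Summits.AtomisticToContinuum.Crystallization.Theorems.HullExactificationCascadeZeroDefectDensityReductionFinal
import HarnessLib

/-!
# SPLIT of the crux `ZeroDefectDensity` (stmt-AtomisticToContinuum-12086, route `HullExactificationCascade`)
# into its ENERGETIC and its GEOMETRIC half — the glue, as a theorem of the tree (crux-strategist, 2026-08-17)

`zeroDefectDensity_of_softKissingOrder_of_localKernel`:

  (Sub₁, ENERGETIC, open)  SOFT KISSING ORDER a.e. — in Lennard-Jones ground states the fraction of particles
      admitting no scale `a > 0` at which every particle within `13/5·a` is `1/4000`-softly twelve-kissed with the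
      gap `7/5·a` tends to `0` (= VERBATIM the registered stub `stub_softKissingOrder` of the live line
      `Cruxes/ZeroDefectDensity/Lines/birth.lean`, lead c5 form; both leads' verdict: promote to an item);
  (Sub₂, GEOMETRIC, provable-now)  the EFFECTIVE LOCAL HALES KERNEL at the line's own constants (one shell,
      tolerance `1/4000`, gap `7/5`): the twelve soft contacts of a softly twelve-kissed centre whose soft
      neighbours are likewise have the fcc or the hcp contact graph (= VERBATIM `localHalesKernel75` of the live
      line, a theorem there modulo the two in-flight stubs `stub_censusCert`, `stub_localStructure`);
  ⟹ `Summit.AtomisticToContinuum.Crystallization.Theses.HullExactificationCascade.ZeroDefectDensity`.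

Proof = the two-shell bookkeeping of the live line at gap `7/5` (weakening `7/5 ≥ 131/100` feeds every landed
c4 lemma: cap atoms p154403, link lemma p152705/p153341, octahedron p152353, the assembly `red_assembly`
discharged by pins p155647 and the fcc/hcp coordinates p157106/p157928, scaling p151864, the density
monotonicity of `…Converse.lean` p147001).  No `sorry`, no new axiom; the two hypotheses are displayed.
This is the glue `Sub₁ → Sub₂ → ZeroDefectDensity` of the planner's typed split of the crux (D-0019 §6,
`ledger route edit --split ZeroDefectDensity --glue-by`). [folklore]
-/

noncomputable section

namespace Summit.AtomisticToContinuum.Crystallization.Theorems.ZeroDefectDensityBirth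

open Filter Topology

/-- Two-shell soft kissing with gap `7/5` weakens to gap `131/100` (the form the landed c4 lemmas consume).
[folklore] -/
theorem split_kissed_131_of_75 {S : Set (EuclideanSpace ℝ (Fin 3))} {u : EuclideanSpace ℝ (Fin 3)}
    (hS : ∀ v ∈ S, dist u v ≤ 13 / 5 → ((∀ w ∈ S, w ≠ v → 1 - 1 / 4000 ≤ dist v w ∧ (dist v w ≤ 1 + 1 / 4000 ∨ 7 / 5 ≤ dist v w)) ∧ {w ∈ S | w ≠ v ∧ dist v w ≤ 1 + 1 / 4000}.ncard = 12)) :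
    ∀ v ∈ S, dist u v ≤ 13 / 5 → ((∀ w ∈ S, w ≠ v → 1 - 1 / 4000 ≤ dist v w ∧ (dist v w ≤ 1 + 1 / 4000 ∨ 131 / 100 ≤ dist v w)) ∧ {w ∈ S | w ≠ v ∧ dist v w ≤ 1 + 1 / 4000}.ncard = 12) := by
  intro v hv hd
  obtain ⟨hsep, hcard⟩ := hS v hv hd
  refine ⟨fun w hw hwv => ?_, hcard⟩
  obtain ⟨h1, h2⟩ := hsep w hw hwv
  refine ⟨h1, ?_⟩
  rcases h2 with h | h
  · exact Or.inl h
  · exact Or.inr (by linarith)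

/-- Under two-shell `1/4000`-soft kissing with gap `7/5` about `u`, the ONE-shell hypotheses of the kernel hold
at `u` and at every soft neighbour `z` of `u` (`dist u v ≤ dist u z + dist z v ≤ 2.0005 ≤ 13/5`). [folklore] -/
theorem split_oneShell_of_twoShell (S : Set (EuclideanSpace ℝ (Fin 3))) (u : EuclideanSpace ℝ (Fin 3))
    (hS : ∀ v ∈ S, dist u v ≤ 13 / 5 → ((∀ w ∈ S, w ≠ v → 1 - 1 / 4000 ≤ dist v w ∧ (dist v w ≤ 1 + 1 / 4000 ∨ 7 / 5 ≤ dist v w)) ∧ {w ∈ S | w ≠ v ∧ dist v w ≤ 1 + 1 / 4000}.ncard = 12))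
    (z : EuclideanSpace ℝ (Fin 3)) (hz : z = u ∨ (z ∈ S ∧ dist u z ≤ 1 + 1 / 4000)) :
    ∀ v ∈ S, dist z v ≤ 1 + 1 / 4000 → ((∀ w ∈ S, w ≠ v → 1 - 1 / 4000 ≤ dist v w ∧ (dist v w ≤ 1 + 1 / 4000 ∨ 7 / 5 ≤ dist v w)) ∧ {w ∈ S | w ≠ v ∧ dist v w ≤ 1 + 1 / 4000}.ncard = 12) := by
  intro v hv hzv
  have hzu : dist u z ≤ 1 + 1 / 4000 := by
    rcases hz with rfl | ⟨-, h⟩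
    · rw [dist_self]; norm_num
    · exact h
  have huv : dist u v ≤ 13 / 5 := by
    have := dist_triangle u z v
    linarith
  exact hS v hv huv

/-- POINTWISE, SCALE `1`: given the kernel `hK`, two-shell `1/4000`-soft kissing with gap `7/5` about `u ∈ S`
forces `SiteGood S u` (the kernel at `u` and at its twelve soft neighbours, then the landed cap atoms and
assembly at gap `131/100`). [folklore] -/
theorem split_siteGood_of_twoShellSoftKissed (hK : ∀ (S : Set (EuclideanSpace ℝ (Fin 3))) (u : EuclideanSpace ℝ (Fin 3)), u ∈ S → (∀ v ∈ S, dist u v ≤ 1 + 1 / 4000 → ((∀ w ∈ S, w ≠ v → 1 - 1 / 4000 ≤ dist v w ∧ (dist v w ≤ 1 + 1 / 4000 ∨ 7 / 5 ≤ dist v w)) ∧ {w ∈ S | w ≠ v ∧ dist v w ≤ 1 + 1 / 4000}.ncard = 12)) → ((∃ e : {w : EuclideanSpace ℝ (Fin 3) // w ∈ S ∧ w ≠ u ∧ dist u w ≤ 1 + 1 / 400} ≃ {q : EuclideanSpace ℝ (Fin 3) // q ∈ Literature.Geometry.DiscreteGeometry.fccKissingPattern}, ∀ w w' : {w : EuclideanSpace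 ℝ (Fin 3) // w ∈ S ∧ w ≠ u ∧ dist u w ≤ 1 + 1 / 400}, w ≠ w' → (dist w.1 w'.1 ≤ 1 + 1 / 400 ↔ dist (e w).1 (e w').1 = 1)) ∨ (∃ e : {w : EuclideanSpace ℝ (Fin 3) // w ∈ S ∧ w ≠ u ∧ dist u w ≤ 1 + 1 / 400} ≃ {q : EuclideanSpace ℝ (Fin 3) // q ∈ Literature.Geometry.DiscreteGeometry.hcpKissingPattern}, ∀ w w' : {w : EuclideanSpace ℝ (Fin 3) // w ∈ S ∧ w ≠ u ∧ dist u w ≤ 1 + 1 / 400}, w ≠ w' → (dist w.1 w'.1 ≤ 1 + 1 / 400 ↔ dist (e w).1 (e w').1 = 1)))) (S : Set (EuclideanSpace ℝ (Fin 3)))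
    (u : EuclideanSpace ℝ (Fin 3)) (hu : u ∈ S) (hS : ∀ v ∈ S, dist u v ≤ 13 / 5 → ((∀ w ∈ S, w ≠ v → 1 - 1 / 4000 ≤ dist v w ∧ (dist v w ≤ 1 + 1 / 4000 ∨ 7 / 5 ≤ dist v w)) ∧ {w ∈ S | w ≠ v ∧ dist v w ≤ 1 + 1 / 4000}.ncard = 12)) :
    Summit.AtomisticToContinuum.Crystallization.Theorems.SiteGood S u := by
  have hIso_u := hK S u hu (split_oneShell_of_twoShell S u hS u (Or.inl rfl))
  have hIso_z : ∀ z ∈ S, z ≠ u → dist u z ≤ 1 + 1 / 4000 → ((∃ e : {w : EuclideanSpace ℝ (Fin 3) // w ∈ S ∧ w ≠ z ∧ dist z w ≤ 1 + 1 / 400} ≃ {q : EuclideanSpace ℝ (Fin 3) // q ∈ Literature.Geometry.DiscreteGeometry.fccKissingPattern}, ∀ w w' : {w : EuclideanSpace ℝ (Fin 3) // w ∈ S ∧ w ≠ z ∧ dist z w ≤ 1 + 1 / 400}, w ≠ w' → (dist w.1 w'.1 ≤ 1 + 1 / 400 ↔ dist (e w).1 (e w').1 = 1)) ∨ (∃ e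 : {w : EuclideanSpace ℝ (Fin 3) // w ∈ S ∧ w ≠ z ∧ dist z w ≤ 1 + 1 / 400} ≃ {q : EuclideanSpace ℝ (Fin 3) // q ∈ Literature.Geometry.DiscreteGeometry.hcpKissingPattern}, ∀ w w' : {w : EuclideanSpace ℝ (Fin 3) // w ∈ S ∧ w ≠ z ∧ dist z w ≤ 1 + 1 / 400}, w ≠ w' → (dist w.1 w'.1 ≤ 1 + 1 / 400 ↔ dist (e w).1 (e w').1 = 1))) :=
    fun z hz _ hdz => hK S z hz (split_oneShell_of_twoShell S u hS z (Or.inr ⟨hz, hdz⟩))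
  have hS' := split_kissed_131_of_75 hS
  have hcaps := stub_capAtoms S u hu hS' hIso_u hIso_z stub_linkLemma.1 stub_linkLemma.2
  exact red_assembly stub_pins stub_coordsFcc stub_coordsHcp S u hu hS' hIso_u hcaps stub_octahedron

/-- **Soft kissing dilates (gap `7/5`).** If `v` is softly twelve-kissed in `S` at scale `a` with gap `7/5·a`,
then so is `a⁻¹ • v` in `(a⁻¹ • ·) '' S` at scale `1`. [folklore] -/
theorem split_softKissing_dilate75 {S : Set (EuclideanSpace ℝ (Fin 3))} {v : EuclideanSpace ℝ (Fin 3)} {a : ℝ}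
    (ha : 0 < a)
    (h : (∀ w ∈ S, w ≠ v → (1 - 1 / 4000) * a ≤ dist v w ∧
        (dist v w ≤ (1 + 1 / 4000) * a ∨ 7 / 5 * a ≤ dist v w)) ∧
      {w ∈ S | w ≠ v ∧ dist v w ≤ (1 + 1 / 4000) * a}.ncard = 12) :
    (∀ w ∈ ((fun p : EuclideanSpace ℝ (Fin 3) => a⁻¹ • p) '' S), w ≠ (a⁻¹ • v) →
        1 - 1 / 4000 ≤ dist (a⁻¹ • v) w ∧
          (dist (a⁻¹ • v) w ≤ 1 + 1 / 4000 ∨ 7 / 5 ≤ dist (a⁻¹ • v) w)) ∧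
      {w ∈ ((fun p : EuclideanSpace ℝ (Fin 3) => a⁻¹ • p) '' S) | w ≠ (a⁻¹ • v) ∧
        dist (a⁻¹ • v) w ≤ 1 + 1 / 4000}.ncard = 12 := by
  obtain ⟨hrad, hcount⟩ := h
  have hinj := dilate_injective ha
  constructor
  · intro w' hw' hne
    obtain ⟨w, hw, rfl⟩ := hw'
    have hwv : w ≠ v := fun h => hne (by rw [h])
    obtain ⟨h1, h2⟩ := hrad w hw hwv
    show 1 - 1 / 4000 ≤ dist (a⁻¹ • v) (a⁻¹ • w) ∧
      (dist (a⁻¹ • v) (a⁻¹ • w) ≤ 1 + 1 / 4000 ∨ 7 / 5 ≤ dist (a⁻¹ • v) (a⁻¹ • w))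
    rw [dist_smul₀, norm_inv, Real.norm_of_nonneg ha.le, inv_mul_eq_div]
    exact ⟨(le_div_iff₀ ha).2 h1,
      h2.imp (fun h => (div_le_iff₀ ha).2 h) (fun h => (le_div_iff₀ ha).2 h)⟩
  · have hset : {w ∈ ((fun p : EuclideanSpace ℝ (Fin 3) => a⁻¹ • p) '' S) | w ≠ (a⁻¹ • v) ∧
        dist (a⁻¹ • v) w ≤ 1 + 1 / 4000} = (fun p : EuclideanSpace ℝ (Fin 3) => a⁻¹ • p) ''
          {w ∈ S | w ≠ v ∧ dist v w ≤ (1 + 1 / 4000) * a} := by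
      ext w'
      simp only [Set.mem_setOf_eq, Set.mem_image]
      constructor
      · rintro ⟨⟨w, hw, rfl⟩, hne, hle⟩
        refine ⟨w, ⟨hw, fun h => hne (by rw [h]), ?_⟩, rfl⟩
        rwa [dist_smul₀, norm_inv, Real.norm_of_nonneg ha.le, inv_mul_eq_div, div_le_iff₀ ha] at hle
      · rintro ⟨w, ⟨hw, hne, hle⟩, rfl⟩
        refine ⟨⟨w, hw, rfl⟩, fun h => hne (hinj h), ?_⟩
        rwa [dist_smul₀, norm_inv, Real.norm_of_nonneg ha.le, inv_mul_eq_div, div_le_iff₀ ha]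
    rw [hset, Set.ncard_image_of_injective _ hinj, hcount]

/-- POINTWISE, ANY SCALE: given the kernel, a `1/4000`-soft-kissed `13/5·a`-neighbourhood with gap `7/5·a`
forces a good shell. [folklore] -/
theorem split_siteGood_of_softKissedNbhd (hK : ∀ (S : Set (EuclideanSpace ℝ (Fin 3))) (u : EuclideanSpace ℝ (Fin 3)), u ∈ S → (∀ v ∈ S, dist u v ≤ 1 + 1 / 4000 → ((∀ w ∈ S, w ≠ v → 1 - 1 / 4000 ≤ dist v w ∧ (dist v w ≤ 1 + 1 / 4000 ∨ 7 / 5 ≤ dist v w)) ∧ {w ∈ S | w ≠ v ∧ dist v w ≤ 1 + 1 / 4000}.ncard = 12)) → ((∃ e : {w : EuclideanSpace ℝ (Fin 3) // w ∈ S ∧ w ≠ u ∧ dist u w ≤ 1 + 1 / 400} ≃ {q : EuclideanSpace ℝ (Fin 3) // q ∈ Literature.Geometry.DiscreteGeometry.fccKissingPattern}, ∀ w w' : {w : EuclideanSpace ℝ (Fin 3) // w ∈ S ∧ w ≠ u ∧ dist u w ≤ 1 + 1 / 400}, w ≠ w' → (dist w.1 w'.1 ≤ 1 + 1 / 400 ↔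 dist (e w).1 (e w').1 = 1)) ∨ (∃ e : {w : EuclideanSpace ℝ (Fin 3) // w ∈ S ∧ w ≠ u ∧ dist u w ≤ 1 + 1 / 400} ≃ {q : EuclideanSpace ℝ (Fin 3) // q ∈ Literature.Geometry.DiscreteGeometry.hcpKissingPattern}, ∀ w w' : {w : EuclideanSpace ℝ (Fin 3) // w ∈ S ∧ w ≠ u ∧ dist u w ≤ 1 + 1 / 400}, w ≠ w' → (dist w.1 w'.1 ≤ 1 + 1 / 400 ↔ dist (e w).1 (e w').1 = 1)))) (S : Set (EuclideanSpace ℝ (Fin 3)))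
    (u : EuclideanSpace ℝ (Fin 3)) (hu : u ∈ S)
    (h : ∃ a : ℝ, 0 < a ∧ ∀ v ∈ S, dist u v ≤ 13 / 5 * a → ((∀ w ∈ S, w ≠ v → (1 - 1 / 4000) * a ≤ dist v w ∧ (dist v w ≤ (1 + 1 / 4000) * a ∨ 7 / 5 * a ≤ dist v w)) ∧ {w ∈ S | w ≠ v ∧ dist v w ≤ (1 + 1 / 4000) * a}.ncard = 12)) :
    Summit.AtomisticToContinuum.Crystallization.Theorems.SiteGood S u := by
  obtain ⟨a, ha, hSK⟩ := h
  refine stub_scaling.1 S u a ha ?_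
  refine split_siteGood_of_twoShellSoftKissed hK _ _ ⟨u, hu, rfl⟩ ?_
  rintro v' ⟨v, hv, rfl⟩ hd
  have hainv : 0 < a⁻¹ := inv_pos.mpr ha
  have hd' : dist u v ≤ 13 / 5 * a := by
    have h1 : dist (a⁻¹ • u) (a⁻¹ • v) = a⁻¹ * dist u v := by
      rw [dist_smul₀, Real.norm_of_nonneg hainv.le]
    rw [h1] at hd
    have := (inv_mul_le_iff₀ ha).mp hd
    linarith
  exact split_softKissing_dilate75 ha (hSK v hv hd')

/-- **THE SPLIT GLUE** (planner, crux-strategist; D-0019 §6 glued split of the crux `ZeroDefectDensity`):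
SOFT KISSING ORDER a.e. (energetic, two shells, tolerance `1/4000`, gap `7/5`) and the EFFECTIVE LOCAL HALES
KERNEL at `(1/4000, 7/5)` (geometric) imply `HullExactificationCascade.ZeroDefectDensity`.  The defect set is
contained in the set of particles without a soft-kissed neighbourhood (`split_siteGood_of_softKissedNbhd`), whose
density tends to `0` by the first hypothesis (`tendsto_density_mono`). [folklore] -/
theorem zeroDefectDensity_of_softKissingOrder_of_localKernel : (∀ (x : (N : ℕ) → (Fin N → EuclideanSpace ℝ (Fin 3))), (∀ N, Literature.MathematicalPhysics.StatisticalMechanics.IsGroundState Literature.MathematicalPhysics.StatisticalMechanics.lennardJones (x N)) → Filter.Tendsto (fun N : ℕ => (Nat.card {i : Fin N // ¬ (∃ a : ℝ, 0 < a ∧ ∀ v ∈ Set.range (x N), dist (x N i) v ≤ 13 / 5 * a → ((∀ w ∈ Set.range (x N), w ≠ v → (1 - 1 / 4000) * a ≤ dist v w ∧ (dist v w ≤ (1 + 1 / 4000) * a ∨ 7 / 5 * a ≤ dist v w)) ∧ {w ∈ Set.range (x N) | w ≠ v ∧ dist v w ≤ (1 + 1 / 4000) * a}.ncard = 12))} :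 ℝ) / (N : ℝ)) Filter.atTop (nhds (0 : ℝ))) → (∀ (S : Set (EuclideanSpace ℝ (Fin 3))) (u : EuclideanSpace ℝ (Fin 3)), u ∈ S → (∀ v ∈ S, dist u v ≤ 1 + 1 / 4000 → ((∀ w ∈ S, w ≠ v → 1 - 1 / 4000 ≤ dist v w ∧ (dist v w ≤ 1 + 1 / 4000 ∨ 7 / 5 ≤ dist v w)) ∧ {w ∈ S | w ≠ v ∧ dist v w ≤ 1 + 1 / 4000}.ncard = 12)) → ((∃ e : {w : EuclideanSpace ℝ (Fin 3) // w ∈ S ∧ w ≠ u ∧ dist u w ≤ 1 + 1 / 400} ≃ {q : EuclideanSpace ℝ (Fin 3) // q ∈ Literature.Geometry.DiscreteGeometry.fccKissingPattern}, ∀ w w' : {w : EuclideanSpace ℝ (Fin 3) // w ∈ S ∧ w ≠ u ∧ dist u w ≤ 1 + 1 / 400}, w ≠ w' → (dist w.1 w'.1 ≤ 1 + 1 / 400 ↔ dist (e w).1 (e w').1 = 1)) ∨ (∃ e : {w : EuclideanSpace ℝ (Fin 3) // w ∈ S ∧ w ≠ u ∧ dist u w ≤ 1 + 1 / 400} ≃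 {q : EuclideanSpace ℝ (Fin 3) // q ∈ Literature.Geometry.DiscreteGeometry.hcpKissingPattern}, ∀ w w' : {w : EuclideanSpace ℝ (Fin 3) // w ∈ S ∧ w ≠ u ∧ dist u w ≤ 1 + 1 / 400}, w ≠ w' → (dist w.1 w'.1 ≤ 1 + 1 / 400 ↔ dist (e w).1 (e w').1 = 1)))) → Summit.AtomisticToContinuum.Crystallization.Theses.HullExactificationCascade.ZeroDefectDensity := by
  intro hSKO hK x hx
  refine tendsto_density_mono
    (P := fun N i => ¬ Summit.AtomisticToContinuum.Crystallization.Theorems.SiteGood (Set.range (x N)) (x N i))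
    ?_ (hSKO x hx)
  intro N i hi hgood
  exact hi (split_siteGood_of_softKissedNbhd hK (Set.range (x N)) (x N i) ⟨i, rfl⟩ hgood)

end Summit.AtomisticToContinuum.Crystallization.Theorems.ZeroDefectDensityBirth

end
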